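import Literature.MathematicalPhysics.QuantumLattice.FreeFermionSectorEnergyDeviation
import Literature.MathematicalPhysics.QuantumLattice.PairCorrelationsProofs
import HarnessLib

/-!
# Pair Gram bounds: `d`-wave pair-field expectations against the quartic occupation means

Family `hubbard` / trunk T-QLATTICE. For ANY vector `ψ` of the fermionic Fock space of the torus
`(ℤ/Lℤ)²` and the hard-core pair modes `b_k = c_{-k↓} c_{k↑}` (`pairMode`):

* **Pair Gram bounds** (`norm_pairCorrelation_le_mul`): for `k ≠ k'`,
  `‖⟨ψ, b_k† b_{k'} ψ⟩‖ ≤ t_k t_{k'}` with `t_k = (u_k v_k)^{1/4}` (written `√(√(u_k v_k))`),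
  `u_k = ⟨n_{k↑} n_{-k↓}⟩` (pair present), `v_k = ⟨(1-n_{k↑})(1-n_{-k↓})⟩` (pair absent):
  Cauchy–Schwarz once as `⟨b_k ψ, b_{k'} ψ⟩` (`norm_pairCorrelation_sq_le_present`) and once,
  using `[b_k†, b_{k'}] = 0`, as `⟨b_{k'}† ψ, b_k† ψ⟩` (`norm_pairCorrelation_sq_le_absent`), then
  the geometric mean; moreover `0 ≤ u_k ≤ x_k`, `0 ≤ v_k ≤ ‖ψ‖² - x_k`, `x_k = ⟨n_{k↑}⟩`
  (`re_expect_pairPresent/Absent_mem_Icc`).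
* **Consequence for the `d`-wave pair field** (`re_expect_pairField_dWave_le`, unit `ψ`):
  `Re ⟨ψ, Δ_d† Δ_d ψ⟩ ≤ 32 L² + 32 (Σ_k t_k)²` (`Δ_d†Δ_d = 8 Σ_{k,k'} ĝ_d(k)ĝ_d(k') b_k†b_{k'}`,
  `|ĝ_d| ≤ 2`, diagonal terms `≤ 1`).

So pair LRO `Re ⟨Δ_d†Δ_d⟩ ≥ a L⁴` needs `Σ_k t_k ≳ √a L²`, i.e. order `L²` Bloch modes with SMEARED
occupation (`t_k⁴ ≤ x_k(1 - x_k)`); the consumer `FreeFermiGasPairingCost.lean` shows that this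
smearing costs kinetic energy at a volume rate in the free Fermi sea.

Sources: J. Bardeen, L. N. Cooper, J. R. Schrieffer, Phys. Rev. 108 (1957) 1175, §II; C. N. Yang,
Rev. Mod. Phys. 34 (1962) 694, §3 (pair-correlation eigenvalue bounds from Cauchy–Schwarz);
J. von Delft, D. C. Ralph, Phys. Rep. 345 (2001) 61, §4.2.3 (hard-core pair algebra). Folklore
finite-dimensional statements; no named facts, no definitions.

## Mathlib / tree search

Tree: `pairMode_commutator_conjTranspose`, `conjTranspose_pairMode_mul_self`,
`conjTranspose_pairField_dWave_mul_self`, `conjTranspose_pairOperator_mul_pairOperator`,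
`momentumNumber_commute`, `momentumNumber_mul_self`, `momentumNumber_conjTranspose`,
`proj_mul_proj_of_commute`, `re_expect_momentumNumber_mem_Icc`, `star_dotProduct_eq_inner`,
`norm_toLp_sq_eq_re`, `Literature.Computability.AlgebraicComplexity.re_dotProduct_mulVec_nonneg`,
`card_torusSite`. Mathlib: `norm_inner_le_norm`, `Real.sqrt_le_sqrt`, `Real.sqrt_mul`,
`Finset.sum_mul_sum`.
-/

noncomputable section

namespace Literature.MathematicalPhysics.QuantumLattice

open Matrix Finset Literature.Probability.LatticeModels
open scoped ComplexOrder ComplexConjugate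

/-! ### Cauchy–Schwarz and projection expectations -/

section CS

variable {n : Type*} [Fintype n]

/-- **Cauchy–Schwarz** for `star a ⬝ᵥ b`, squared: `‖a⋆·b‖² ≤ Re (a⋆·a) · Re (b⋆·b)`. [folklore] -/
theorem norm_star_dotProduct_sq_le (a b : n → ℂ) :
    ‖star a ⬝ᵥ b‖ ^ 2 ≤ (star a ⬝ᵥ a).re * (star b ⬝ᵥ b).re := by
  rw [star_dotProduct_eq_inner, ← norm_toLp_sq_eq_re, ← norm_toLp_sq_eq_re, ← mul_pow]
  exact pow_le_pow_left₀ (norm_nonneg _) (norm_inner_le_norm _ _) 2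

/-- `⟨ψ, Aᴴ B ψ⟩ = ⟨A ψ, B ψ⟩`. [folklore] -/
theorem star_dotProduct_conjTranspose_mul_mulVec (A B : Matrix n n ℂ) (ψ : n → ℂ) :
    star ψ ⬝ᵥ ((Aᴴ * B) *ᵥ ψ) = star (A *ᵥ ψ) ⬝ᵥ (B *ᵥ ψ) := by
  rw [← mulVec_mulVec, dotProduct_mulVec, star_mulVec]

variable [DecidableEq n]

/-- For commuting Hermitian idempotents `P, A`: `Re ⟨ψ, P A ψ⟩ ≤ Re ⟨ψ, P ψ⟩`
(`P - PA = P(1 - A)` is again a Hermitian idempotent). [folklore] -/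
theorem re_expect_mul_le_of_commute_proj {P A : Matrix n n ℂ} (hP : Pᴴ = P) (hPP : P * P = P)
    (hA : Aᴴ = A) (hAA : A * A = A) (h : Commute P A) (ψ : n → ℂ) :
    (star ψ ⬝ᵥ ((P * A) *ᵥ ψ)).re ≤ (star ψ ⬝ᵥ (P *ᵥ ψ)).re := by
  have hB : (1 - A)ᴴ = 1 - A := by rw [conjTranspose_sub, conjTranspose_one, hA]
  have hBB : (1 - A) * (1 - A) = 1 - A := by
    rw [Matrix.sub_mul, Matrix.one_mul, Matrix.mul_sub, Matrix.mul_one, hAA, sub_self, sub_zero]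
  have hc : Commute P (1 - A) := (Commute.one_right P).sub_right h
  obtain ⟨h1, h2⟩ := proj_mul_proj_of_commute hP hPP hB hBB hc
  have h0 := Literature.Computability.AlgebraicComplexity.re_dotProduct_mulVec_nonneg
    (show (P * (1 - A)).IsHermitian from h1) h2 ψ
  rw [Matrix.mul_sub, Matrix.mul_one, sub_mulVec, dotProduct_sub, Complex.sub_re] at h0
  linarith

end CS

/-! ### Pair Gram bounds -/

section Gram

variable {L : ℕ} [NeZero L]

/-- `b_k b_k† = (1 - n_{k↑})(1 - n_{-k↓})`. von Delft–Ralph (2001) §4.2.3. [folklore] -/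
theorem pairMode_mul_conjTranspose_self (k : TorusSite 2 L) :
    pairMode k * (pairMode k)ᴴ = (1 - momentumNumber k 0) * (1 - momentumNumber (-k) 1) := by
  have h := pairMode_commutator_conjTranspose k k
  rw [if_pos rfl, conjTranspose_pairMode_mul_self, sub_eq_iff_eq_add] at h
  rw [h, Matrix.sub_mul, Matrix.one_mul, Matrix.mul_sub, Matrix.mul_one]
  abel

/-- `[b_k†, b_{k'}] = 0` for `k ≠ k'`: `b_k† b_{k'} = b_{k'} b_k†`. von Delft–Ralph (2001) §4.2.3.
[folklore] -/
theorem conjTranspose_pairMode_mul_pairMode_of_ne {k k' : TorusSite 2 L} (h : k ≠ k') :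
    (pairMode k)ᴴ * pairMode k' = pairMode k' * (pairMode k)ᴴ := by
  have h1 := pairMode_commutator_conjTranspose k' k
  rw [if_neg (Ne.symm h), sub_eq_zero] at h1
  exact h1.symm

/-- `n_{k↑} n_{-k↓}` is a Hermitian idempotent. [folklore] -/
theorem proj_momentumNumber_mul (k : TorusSite 2 L) :
    (momentumNumber k 0 * momentumNumber (-k) 1)ᴴ = momentumNumber k 0 * momentumNumber (-k) 1 ∧
      momentumNumber k 0 * momentumNumber (-k) 1 * (momentumNumber k 0 * momentumNumber (-k) 1) =
        momentumNumber k 0 * momentumNumber (-k) 1 :=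
  proj_mul_proj_of_commute (momentumNumber_conjTranspose k 0) (momentumNumber_mul_self k 0)
    (momentumNumber_conjTranspose (-k) 1) (momentumNumber_mul_self (-k) 1)
    (momentumNumber_commute k (-k) 0 1)

/-- `1 - n_{kσ}` is a Hermitian idempotent commuting with every `n_{k'σ'}`. [folklore] -/
theorem proj_one_sub_momentumNumber (k : TorusSite 2 L) (σ : Fin 2) :
    (1 - momentumNumber k σ)ᴴ = 1 - momentumNumber k σ ∧
      (1 - momentumNumber k σ) * (1 - momentumNumber k σ) = 1 - momentumNumber k σ := by
  refine ⟨by rw [conjTranspose_sub, conjTranspose_one, momentumNumber_conjTranspose], ?_⟩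
  rw [Matrix.sub_mul, Matrix.one_mul, Matrix.mul_sub, Matrix.mul_one, momentumNumber_mul_self,
    sub_self, sub_zero]

/-- `(1 - n_{k↑})(1 - n_{-k↓})` is a Hermitian idempotent. [folklore] -/
theorem proj_one_sub_momentumNumber_mul (k : TorusSite 2 L) :
    ((1 - momentumNumber k 0) * (1 - momentumNumber (-k) 1))ᴴ =
        (1 - momentumNumber k 0) * (1 - momentumNumber (-k) 1) ∧
      (1 - momentumNumber k 0) * (1 - momentumNumber (-k) 1) *
          ((1 - momentumNumber k 0) * (1 - momentumNumber (-k) 1)) =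
        (1 - momentumNumber k 0) * (1 - momentumNumber (-k) 1) :=
  proj_mul_proj_of_commute (proj_one_sub_momentumNumber k 0).1 (proj_one_sub_momentumNumber k 0).2
    (proj_one_sub_momentumNumber (-k) 1).1 (proj_one_sub_momentumNumber (-k) 1).2
    ((Commute.one_right _).sub_right ((Commute.one_left _).sub_left (momentumNumber_commute k (-k) 0 1)))

/-- `0 ≤ u_k = Re ⟨ψ, n_{k↑}n_{-k↓} ψ⟩ ≤ x_k = Re ⟨ψ, n_{k↑} ψ⟩`. [folklore] -/
theorem re_expect_pairPresent_mem_Icc (k : TorusSite 2 L) (ψ : Fock (Orb (FermionTorus 2 L))) :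
    (star ψ ⬝ᵥ ((momentumNumber k 0 * momentumNumber (-k) 1) *ᵥ ψ)).re ∈
      Set.Icc 0 (star ψ ⬝ᵥ (momentumNumber k 0 *ᵥ ψ)).re :=
  ⟨Literature.Computability.AlgebraicComplexity.re_dotProduct_mulVec_nonneg
      (show (momentumNumber k 0 * momentumNumber (-k) 1).IsHermitian from (proj_momentumNumber_mul k).1)
      (proj_momentumNumber_mul k).2 ψ,
    re_expect_mul_le_of_commute_proj (momentumNumber_conjTranspose k 0) (momentumNumber_mul_self k 0)
      (momentumNumber_conjTranspose (-k) 1) (momentumNumber_mul_self (-k) 1)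
      (momentumNumber_commute k (-k) 0 1) ψ⟩

/-- `0 ≤ v_k = Re ⟨ψ, (1-n_{k↑})(1-n_{-k↓}) ψ⟩ ≤ Re ⟨ψ, ψ⟩ - x_k`. [folklore] -/
theorem re_expect_pairAbsent_mem_Icc (k : TorusSite 2 L) (ψ : Fock (Orb (FermionTorus 2 L))) :
    (star ψ ⬝ᵥ (((1 - momentumNumber k 0) * (1 - momentumNumber (-k) 1)) *ᵥ ψ)).re ∈
      Set.Icc 0 ((star ψ ⬝ᵥ ψ).re - (star ψ ⬝ᵥ (momentumNumber k 0 *ᵥ ψ)).re) := by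
  refine ⟨Literature.Computability.AlgebraicComplexity.re_dotProduct_mulVec_nonneg
      (show ((1 - momentumNumber k 0) * (1 - momentumNumber (-k) 1)).IsHermitian from
        (proj_one_sub_momentumNumber_mul k).1) (proj_one_sub_momentumNumber_mul k).2 ψ, ?_⟩
  have h := re_expect_mul_le_of_commute_proj (proj_one_sub_momentumNumber k 0).1
    (proj_one_sub_momentumNumber k 0).2 (proj_one_sub_momentumNumber (-k) 1).1
    (proj_one_sub_momentumNumber (-k) 1).2
    ((Commute.one_right _).sub_right ((Commute.one_left _).sub_left (momentumNumber_commute k (-k) 0 1))) ψ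
  rw [sub_mulVec, one_mulVec, dotProduct_sub, Complex.sub_re] at h
  exact h

/-- **First Gram bound**: `‖⟨ψ, b_k† b_{k'} ψ⟩‖² ≤ u_k u_{k'}` (Cauchy–Schwarz on `⟨b_kψ, b_{k'}ψ⟩`,
`‖b_kψ‖² = u_k`). Yang (1962) §3. [folklore] -/
theorem norm_pairCorrelation_sq_le_present (k k' : TorusSite 2 L) (ψ : Fock (Orb (FermionTorus 2 L))) :
    ‖star ψ ⬝ᵥ (((pairMode k)ᴴ * pairMode k') *ᵥ ψ)‖ ^ 2 ≤
      (star ψ ⬝ᵥ ((momentumNumber k 0 * momentumNumber (-k) 1) *ᵥ ψ)).re *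
        (star ψ ⬝ᵥ ((momentumNumber k' 0 * momentumNumber (-k') 1) *ᵥ ψ)).re := by
  rw [star_dotProduct_conjTranspose_mul_mulVec, ← conjTranspose_pairMode_mul_self,
    ← conjTranspose_pairMode_mul_self, star_dotProduct_conjTranspose_mul_mulVec,
    star_dotProduct_conjTranspose_mul_mulVec]
  exact norm_star_dotProduct_sq_le _ _

/-- **Second Gram bound** (`k ≠ k'`): `‖⟨ψ, b_k† b_{k'} ψ⟩‖² ≤ v_{k'} v_k` (write
`b_k† b_{k'} = b_{k'} b_k†` and Cauchy–Schwarz on `⟨b_{k'}†ψ, b_k†ψ⟩`, `‖b_k†ψ‖² = v_k`).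
Yang (1962) §3. [folklore] -/
theorem norm_pairCorrelation_sq_le_absent {k k' : TorusSite 2 L} (h : k ≠ k')
    (ψ : Fock (Orb (FermionTorus 2 L))) :
    ‖star ψ ⬝ᵥ (((pairMode k)ᴴ * pairMode k') *ᵥ ψ)‖ ^ 2 ≤
      (star ψ ⬝ᵥ (((1 - momentumNumber k' 0) * (1 - momentumNumber (-k') 1)) *ᵥ ψ)).re *
        (star ψ ⬝ᵥ (((1 - momentumNumber k 0) * (1 - momentumNumber (-k) 1)) *ᵥ ψ)).re := by
  rw [conjTranspose_pairMode_mul_pairMode_of_ne h, ← pairMode_mul_conjTranspose_self,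
    ← pairMode_mul_conjTranspose_self]
  have e1 : pairMode k' * (pairMode k)ᴴ = ((pairMode k')ᴴ)ᴴ * (pairMode k)ᴴ := by
    rw [conjTranspose_conjTranspose]
  have e2 : pairMode k' * (pairMode k')ᴴ = ((pairMode k')ᴴ)ᴴ * (pairMode k')ᴴ := by
    rw [conjTranspose_conjTranspose]
  have e3 : pairMode k * (pairMode k)ᴴ = ((pairMode k)ᴴ)ᴴ * (pairMode k)ᴴ := by
    rw [conjTranspose_conjTranspose]
  rw [e1, e2, e3, star_dotProduct_conjTranspose_mul_mulVec, star_dotProduct_conjTranspose_mul_mulVec,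
    star_dotProduct_conjTranspose_mul_mulVec]
  exact norm_star_dotProduct_sq_le _ _

omit [NeZero L] in
/-- From `m² ≤ A`, `m² ≤ B` (`m, A, B ≥ 0`): `m ≤ √(√(A·B))`. [folklore] -/
private theorem le_sqrt_sqrt_of_sq_le {m A B : ℝ} (hm : 0 ≤ m) (hA : 0 ≤ A)
    (h1 : m ^ 2 ≤ A) (h2 : m ^ 2 ≤ B) : m ≤ Real.sqrt (Real.sqrt (A * B)) := by
  have h4 : (m ^ 2) ^ 2 ≤ A * B := by
    rw [sq (m ^ 2)]
    exact mul_le_mul h1 h2 (sq_nonneg _) hA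
  have h5 : m ^ 2 ≤ Real.sqrt (A * B) := by
    rw [← Real.sqrt_sq (sq_nonneg m)]
    exact Real.sqrt_le_sqrt h4
  rw [← Real.sqrt_sq hm]
  exact Real.sqrt_le_sqrt h5

/-- **Pair Gram bound**: for `k ≠ k'`, `‖⟨ψ, b_k† b_{k'} ψ⟩‖ ≤ t_k · t_{k'}` with
`t_q = √(√(u_q v_q))` (`= (u_q v_q)^{1/4}`), `u_q = ⟨n_{q↑}n_{-q↓}⟩`, `v_q = ⟨(1-n_{q↑})(1-n_{-q↓})⟩`
(geometric mean of the two Gram bounds). [folklore] -/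
theorem norm_pairCorrelation_le_mul {k k' : TorusSite 2 L} (h : k ≠ k')
    (ψ : Fock (Orb (FermionTorus 2 L))) :
    ‖star ψ ⬝ᵥ (((pairMode k)ᴴ * pairMode k') *ᵥ ψ)‖ ≤
      Real.sqrt (Real.sqrt
        ((star ψ ⬝ᵥ ((momentumNumber k 0 * momentumNumber (-k) 1) *ᵥ ψ)).re *
          (star ψ ⬝ᵥ (((1 - momentumNumber k 0) * (1 - momentumNumber (-k) 1)) *ᵥ ψ)).re)) *
      Real.sqrt (Real.sqrt
        ((star ψ ⬝ᵥ ((momentumNumber k' 0 * momentumNumber (-k') 1) *ᵥ ψ)).re *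
          (star ψ ⬝ᵥ (((1 - momentumNumber k' 0) * (1 - momentumNumber (-k') 1)) *ᵥ ψ)).re)) := by
  have hu := (re_expect_pairPresent_mem_Icc k ψ).1
  have hu' := (re_expect_pairPresent_mem_Icc k' ψ).1
  have hv := (re_expect_pairAbsent_mem_Icc k ψ).1
  have hv' := (re_expect_pairAbsent_mem_Icc k' ψ).1
  have h1 := norm_pairCorrelation_sq_le_present k k' ψ
  have h2 := norm_pairCorrelation_sq_le_absent h ψ
  generalize (star ψ ⬝ᵥ ((momentumNumber k 0 * momentumNumber (-k) 1) *ᵥ ψ)).re = U at *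
  generalize (star ψ ⬝ᵥ ((momentumNumber k' 0 * momentumNumber (-k') 1) *ᵥ ψ)).re = U' at *
  generalize (star ψ ⬝ᵥ (((1 - momentumNumber k 0) * (1 - momentumNumber (-k) 1)) *ᵥ ψ)).re = V at *
  generalize (star ψ ⬝ᵥ (((1 - momentumNumber k' 0) * (1 - momentumNumber (-k') 1)) *ᵥ ψ)).re = V' at *
  rw [← Real.sqrt_mul (Real.sqrt_nonneg _), ← Real.sqrt_mul (mul_nonneg hu hv),
    show U * V * (U' * V') = U * U' * (V' * V) by ring]
  exact le_sqrt_sqrt_of_sq_le (norm_nonneg _) (mul_nonneg hu hu') h1 h2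

end Gram

/-! ### The pair-field expectation against the quartic means `t_k` -/

section PairField

variable {L : ℕ} [NeZero L]

/-- **`Re ⟨ψ, Δ_d† Δ_d ψ⟩ ≤ 32 L² + 32 (Σ_k t_k)²`** for a unit vector `ψ`, with the quartic means
`t_k = √(√(u_k v_k))` of the pair Gram bounds (`Δ_d†Δ_d = 8 Σ_{k,k'} ĝ_d(k)ĝ_d(k') b_k†b_{k'}`,
`|ĝ_d| ≤ 2`, diagonal terms `≤ 1`, off-diagonal terms `≤ t_k t_{k'}`). Bardeen–Cooper–Schrieffer
(1957) §II; Yang (1962) §3. [folklore] -/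
theorem re_expect_pairField_dWave_le (ψ : Fock (Orb (FermionTorus 2 L))) (h1 : star ψ ⬝ᵥ ψ = 1) :
    (star ψ ⬝ᵥ (((pairField dWaveFormFactor L)ᴴ * pairField dWaveFormFactor L) *ᵥ ψ)).re ≤
      32 * (L : ℝ) ^ 2 + 32 * (∑ k : TorusSite 2 L, Real.sqrt (Real.sqrt
        ((star ψ ⬝ᵥ ((momentumNumber k 0 * momentumNumber (-k) 1) *ᵥ ψ)).re *
          (star ψ ⬝ᵥ (((1 - momentumNumber k 0) * (1 - momentumNumber (-k) 1)) *ᵥ ψ)).re))) ^ 2 := by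
  set t : TorusSite 2 L → ℝ := fun k => Real.sqrt (Real.sqrt
        ((star ψ ⬝ᵥ ((momentumNumber k 0 * momentumNumber (-k) 1) *ᵥ ψ)).re *
          (star ψ ⬝ᵥ (((1 - momentumNumber k 0) * (1 - momentumNumber (-k) 1)) *ᵥ ψ)).re)) with ht
  have ht0 : ∀ k, 0 ≤ t k := fun k => Real.sqrt_nonneg _
  -- expand `Δ_d†Δ_d`
  rw [conjTranspose_pairField_dWave_mul_self, conjTranspose_pairOperator_mul_pairOperator]
  simp only [Matrix.smul_mulVec, dotProduct_smul, Matrix.sum_mulVec, dotProduct_sum, smul_eq_mul,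
    Complex.re_ofReal_mul, Complex.re_sum]
  -- termwise bound
  have hg : ∀ k : TorusSite 2 L, |dWaveGap k| ≤ 2 := fun k => by
    unfold dWaveGap
    have ha := Real.abs_cos_le_one (latticeMomentum L k 0)
    have hb := Real.abs_cos_le_one (latticeMomentum L k 1)
    calc |Real.cos (latticeMomentum L k 0) - Real.cos (latticeMomentum L k 1)|
        ≤ |Real.cos (latticeMomentum L k 0)| + |Real.cos (latticeMomentum L k 1)| := abs_sub _ _
      _ ≤ 2 := by linarith
  have hterm : ∀ k k' : TorusSite 2 L,
      (((dWaveGap k : ℂ) * (dWaveGap k' : ℂ)) *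
        (star ψ ⬝ᵥ (((pairMode k)ᴴ * pairMode k') *ᵥ ψ))).re ≤
        (if k = k' then 4 else 0) + 4 * (t k * t k') := by
    intro k k'
    have hre := Complex.re_le_norm (((dWaveGap k : ℂ) * (dWaveGap k' : ℂ)) *
        (star ψ ⬝ᵥ (((pairMode k)ᴴ * pairMode k') *ᵥ ψ)))
    rw [norm_mul, norm_mul, Complex.norm_real, Complex.norm_real, Real.norm_eq_abs,
      Real.norm_eq_abs] at hre
    have hgg : |dWaveGap k| * |dWaveGap k'| ≤ 4 := by
      have := hg k; have := hg k'
      nlinarith [abs_nonneg (dWaveGap k), abs_nonneg (dWaveGap k')]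
    have hM0 := norm_nonneg (star ψ ⬝ᵥ (((pairMode k)ᴴ * pairMode k') *ᵥ ψ))
    by_cases hkk : k = k'
    · subst hkk
      rw [if_pos rfl]
      -- `‖M_kk‖ ≤ 1`
      have hsq := norm_pairCorrelation_sq_le_present k k ψ
      have hu := re_expect_pairPresent_mem_Icc k ψ
      have hx := (re_expect_momentumNumber_mem_Icc k 0 ψ).2
      rw [h1, Complex.one_re] at hx
      have hu1 : (star ψ ⬝ᵥ ((momentumNumber k 0 * momentumNumber (-k) 1) *ᵥ ψ)).re ≤ 1 :=
        hu.2.trans hx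
      have hM1 : ‖star ψ ⬝ᵥ (((pairMode k)ᴴ * pairMode k) *ᵥ ψ)‖ ≤ 1 := by
        have hsq1 : ‖star ψ ⬝ᵥ (((pairMode k)ᴴ * pairMode k) *ᵥ ψ)‖ ^ 2 ≤ 1 :=
          hsq.trans (by nlinarith [hu.1])
        nlinarith [hM0]
      nlinarith [ht0 k, mul_nonneg (mul_nonneg (abs_nonneg (dWaveGap k)) (abs_nonneg (dWaveGap k))) hM0]
    · rw [if_neg hkk, zero_add]
      have hM := norm_pairCorrelation_le_mul hkk ψ
      change ‖star ψ ⬝ᵥ (((pairMode k)ᴴ * pairMode k') *ᵥ ψ)‖ ≤ t k * t k' at hM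
      nlinarith [mul_nonneg (mul_nonneg (abs_nonneg (dWaveGap k)) (abs_nonneg (dWaveGap k'))) hM0,
        mul_nonneg (ht0 k) (ht0 k')]
  have hsum : ∑ k : TorusSite 2 L, ∑ k' : TorusSite 2 L,
      (((dWaveGap k : ℂ) * (dWaveGap k' : ℂ)) *
        (star ψ ⬝ᵥ (((pairMode k)ᴴ * pairMode k') *ᵥ ψ))).re ≤
        4 * (L : ℝ) ^ 2 + 4 * (∑ k, t k) ^ 2 := by
    calc _ ≤ ∑ k : TorusSite 2 L, ∑ k' : TorusSite 2 L, ((if k = k' then (4 : ℝ) else 0) + 4 * (t k * t k')) :=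
          Finset.sum_le_sum fun k _ => Finset.sum_le_sum fun k' _ => hterm k k'
      _ = 4 * (L : ℝ) ^ 2 + 4 * (∑ k, t k) ^ 2 := by
          simp only [Finset.sum_add_distrib, Finset.sum_ite_eq, Finset.mem_univ, if_true,
            Finset.sum_const, Finset.card_univ, card_torusSite, nsmul_eq_mul, ← Finset.mul_sum]
          rw [← Finset.sum_mul]
          push_cast
          ring
  nlinarith

end PairField

end Literature.MathematicalPhysics.QuantumLattice
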